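import Summits.CriticalPhenomena.PercolationContinuityZ3.Theorems.PercNearOneGluingNoHeavyConstsLinearLowerTailTwoGluedBlocks
import Summits.CriticalPhenomena.PercolationContinuityZ3.Theorems.PercNearOneGluingNoHeavyConstsLinearLowerTailLowMean
import HarnessLib

/-!
# (LT³⁄₂) when one glued block has size at least `κ·EN − 2`, or two glued blocks have total size at least `κ·EN − 1`

builds on p205010 (kernel theorem, internal audit signed; external expert review pending)

PAPER-2 track "percolation constants", part (ii), seat `prim-consts-1`, gen 11 (lane index `run/shared/lean/prim/consts/CONSTANTS.md`,
row A19, §4 N37; memo `FROM-prim-consts-1-g11-GLUED-BLOCK.md` §1).  Support file for the crux `NoHeavyLowerTail`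
(stmt-CriticalPhenomena-4575; `--supports`): theorems only, no definitions, no sorries, standard axioms.  Mean-aware sharpening of
`…ConstsLinearLowerTailTwoGluedBlocks` (whose thresholds use only `EN ≤ |A|`).

Notation: finite weighted graph on `Fin n` (`μ = prodBernoulli w`), relay set `A`, observer `o` (no hypothesis), `N = |C(o) ∩ A|`,
`EN = Σ_{a∈A} P(o ↔ a)`, `s ≥ max_{a,a'∈A} P(a ↮ a')`, bad event `{1 ≤ N < κ·EN}`; glued blocks `B`, `B₁`, `B₂ ⊆ A` (`P(t ↮ b) = 0` on
the block, `t` any vertex); no sign or size condition on `κ` is needed in this file.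

THE THEOREMS (the block method with the threshold `k` chosen from `EN` instead of `|A|`):
* `Consts.real_lowerTail_le_three_halves_of_two_glued_blocks_mean` — disjoint nonempty glued blocks with **`κ·EN ≤ |B₁| + |B₂| + 1`**
  ⇒ `P(1 ≤ N < κ·EN) ≤ (3/2)·s` (any observer).  The glued-fraction theorem (`…GluedFraction`, two marked points) needs
  `κ·EN ≤ |B₁| + |B₂|`; the extra point of slack is bought by the three-point bound at the free points
  (`Consts.real_blockDeficit_two_blocks_le` with `k = min(|B₁| + |B₂| + 1, |A|)`).
* `Consts.real_lowerTail_le_three_halves_of_glued_block_mean` — one nonempty glued block with **`κ·EN ≤ |B| + 2`** ⇒ `(3/2)·s`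
  (a free relay point serves as the second block; `|B| = 1, 2` are inside the low-mean theorem `κ·EN ≤ 4` of `…LowMean`, `|B| ≥ 3` is
  new; with `EN ≤ |A|` and `κ ≤ 2/3` it contains `…_of_glued_block_half`).
* `Consts.linearLowerTailThreeHalves_of_glued_block_mean` — the conjecture shape: for `0 < κ ≤ 2/3`, if some vertex `t` has
  `κ·EN ≤ #{a ∈ A : P(t ↮ a) = 0} + 2`, then `P(1 ≤ N < κ·EN) ≤ (3/2)·s` (no glued point at all: `κ·EN ≤ 2`, inside `…LowMean`).
Given `κ ≤ 2/3` and `EN ≤ |A|` these contain `Consts.real_lowerTail_le_three_halves_of_two_glued_blocks` (`2|F| ≤ |B₁|+|B₂|+3 ⇒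
κ·EN ≤ |B₁|+|B₂|+1`) and `…_of_glued_block_half`.
READING: one glued group of size `κ·EN − 2` — wherever the observer sits and however the other relay points are wired — already forces
the three-halves bound; e.g. at `κ = 2/3` a block of `10` glued points controls every instance with `EN ≤ 18`, of any size.
References: G. Kozma, N. Nitzan, arXiv:2401.12397 (2024), Conjecture 1 (p. 3), Conjecture 4 (p. 32); G. Grimmett, *Percolation* (1999), §1.3.
-/

noncomputable section

namespace Summit.CriticalPhenomena.PercolationContinuityZ3.Theorems

open MeasureTheory Set Literature.Probability.LatticeModels Literature.Probability.Percolation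
open scoped Classical

namespace Consts

/-- **Two glued blocks of total size at least `κ·EN − 1`.**  Disjoint nonempty `B₁, B₂ ⊆ A`, almost surely glued to `t₁, t₂`, with
`κ·EN ≤ |B₁| + |B₂| + 1` and `κ ≤ 1`.  Then `P(1 ≤ N < κ·EN) ≤ (3/2)·s` for every observer.  [Footprint transfer at
`k = min(|B₁| + |B₂| + 1, |A|)`: the bad event gives `N < κ·EN ≤ |B₁| + |B₂| + 1` and `N < κ·EN ≤ EN ≤ |A|`, so `N < k`; and
`k + |F| ≤ |A| + 1` in both cases of the minimum, so `Consts.real_blockDeficit_two_blocks_le` bounds every block deficit.]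
[cite: KozmaNitzan2024, Conj. 1 (p. 3)] -/
theorem real_lowerTail_le_three_halves_of_two_glued_blocks_mean (n : ℕ) (w : Sym2 (Fin n) → unitInterval) (A : Finset (Fin n))
    (o t₁ t₂ : Fin n) (B₁ B₂ : Finset (Fin n)) (hB₁A : B₁ ⊆ A) (hB₂A : B₂ ⊆ A) (hdisj : Disjoint B₁ B₂)
    (hne₁ : B₁.Nonempty) (hne₂ : B₂.Nonempty)
    (hglue₁ : ∀ b ∈ B₁, (prodBernoulli w).real (openConn t₁ b)ᶜ = 0)
    (hglue₂ : ∀ b ∈ B₂, (prodBernoulli w).real (openConn t₂ b)ᶜ = 0) {κ s : ℝ} (hκ1 : κ ≤ 1)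
    (hEN : κ * (∑ a ∈ A, (prodBernoulli w).real (openConn o a)) ≤ (B₁.card + B₂.card + 1 : ℕ)) (hs : 0 ≤ s)
    (hrel : ∀ a ∈ A, ∀ a' ∈ A, (prodBernoulli w).real (openConn a a')ᶜ ≤ s) :
    (prodBernoulli w).real {ω : BondConfig (Fin n) | 1 ≤ (A.filter fun a => ω ∈ openConn o a).card ∧
        ((A.filter fun a => ω ∈ openConn o a).card : ℝ) < κ * (∑ a ∈ A, (prodBernoulli w).real (openConn o a))} ≤
      3 / 2 * s := by
  set μ := prodBernoulli w with hμ
  have hFA := Finset.card_sdiff_add_card_eq_card (Finset.union_subset hB₁A hB₂A)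
  have hU : (B₁ ∪ B₂).card = B₁.card + B₂.card := Finset.card_union_of_disjoint hdisj
  set k : ℕ := min (B₁.card + B₂.card + 1) A.card with hk
  have hkA : k ≤ A.card := min_le_right _ _
  have hkB : k ≤ B₁.card + B₂.card + 1 := min_le_left _ _
  have hFk : k + (A \ (B₁ ∪ B₂)).card ≤ A.card + 1 := by
    rcases Nat.le_total (B₁.card + B₂.card + 1) A.card with h | h
    · rw [hk, min_eq_left h]; omega
    · rw [hk, min_eq_right h]; omega
  have hblk : ∀ a ∈ A, μ.real {ω : BondConfig (Fin n) | (A.filter fun b => ω ∈ openConn a b).card < k} ≤ 3 / 2 * s :=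
    fun a ha => real_blockDeficit_two_blocks_le n w A t₁ t₂ B₁ B₂ hB₁A hB₂A hdisj hne₁ hne₂ hglue₁ hglue₂ k hkA hFk hrel a ha
  have htr := lowerTail_le_blockDeficit n w A o k (3 / 2 * s) hblk
  have h32 : 3 / 2 * s * μ.real (⋃ a ∈ A, openConn o a) ≤ 3 / 2 * s := by
    have h0 : 0 ≤ 3 / 2 * s := by linarith
    have h1 : μ.real (⋃ a ∈ A, openConn o a) ≤ 1 := measureReal_le_one
    nlinarith [measureReal_nonneg (μ := μ) (s := ⋃ a ∈ A, openConn o a)]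
  refine le_trans (measureReal_mono ?_) (htr.trans h32)
  intro ω hω
  simp only [mem_setOf_eq] at hω ⊢
  obtain ⟨h1, hlt⟩ := hω
  refine ⟨h1, ?_⟩
  -- `N < κ·EN ≤ |B₁| + |B₂| + 1` and `N < κ·EN ≤ EN ≤ |A|`, so `N < k`
  have hEN0 : (0 : ℝ) ≤ ∑ a ∈ A, μ.real (openConn o a) := Finset.sum_nonneg fun a _ => measureReal_nonneg
  have hENA : (∑ a ∈ A, μ.real (openConn o a)) ≤ A.card := sum_real_openConn_le_card n w A o
  have hκEN : κ * (∑ a ∈ A, μ.real (openConn o a)) ≤ (A.card : ℝ) := by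
    calc κ * (∑ a ∈ A, μ.real (openConn o a)) ≤ 1 * (∑ a ∈ A, μ.real (openConn o a)) :=
          mul_le_mul_of_nonneg_right hκ1 hEN0
      _ ≤ A.card := by rw [one_mul]; exact hENA
  have hNB : ((A.filter fun a => ω ∈ openConn o a).card : ℝ) < ((B₁.card + B₂.card + 1 : ℕ) : ℝ) := lt_of_lt_of_le hlt hEN
  have hNB' : (A.filter fun a => ω ∈ openConn o a).card < B₁.card + B₂.card + 1 := by exact_mod_cast hNB
  have hNA : ((A.filter fun a => ω ∈ openConn o a).card : ℝ) < (A.card : ℝ) := lt_of_lt_of_le hlt hκEN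
  have hNA' : (A.filter fun a => ω ∈ openConn o a).card < A.card := by exact_mod_cast hNA
  exact lt_min hNB' hNA'

/-- **One glued block of size at least `κ·EN − 2`.**  Nonempty `B ⊆ A` almost surely glued to `t`, with `κ·EN ≤ |B| + 2` and `κ ≤ 1`.
Then `P(1 ≤ N < κ·EN) ≤ (3/2)·s` for every observer.  (A free relay point serves as the second block of
`Consts.real_lowerTail_le_three_halves_of_two_glued_blocks_mean`; with no free point,
`Consts.real_lowerTail_le_three_halves_of_glued_block` applies — for this we also assume `0 < κ ≤ 2/3`, as everywhere in the
lane.)  Sizes `|B| ≤ 2` are inside `κ·EN ≤ 4` (`…LowMean`); `|B| ≥ 3` is new; with `EN ≤ |A|`, `κ ≤ 2/3` it contains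
`Consts.real_lowerTail_le_three_halves_of_glued_block_half`. [cite: KozmaNitzan2024, Conj. 1 (p. 3)] -/
theorem real_lowerTail_le_three_halves_of_glued_block_mean (n : ℕ) (w : Sym2 (Fin n) → unitInterval) (A : Finset (Fin n))
    (o t : Fin n) (B : Finset (Fin n)) (hBA : B ⊆ A) (hne : B.Nonempty)
    (hglue : ∀ b ∈ B, (prodBernoulli w).real (openConn t b)ᶜ = 0) {κ s : ℝ} (hκ0 : 0 < κ) (hκ : κ ≤ 2 / 3)
    (hEN : κ * (∑ a ∈ A, (prodBernoulli w).real (openConn o a)) ≤ (B.card + 2 : ℕ)) (hs : 0 ≤ s)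
    (hrel : ∀ a ∈ A, ∀ a' ∈ A, (prodBernoulli w).real (openConn a a')ᶜ ≤ s) :
    (prodBernoulli w).real {ω : BondConfig (Fin n) | 1 ≤ (A.filter fun a => ω ∈ openConn o a).card ∧
        ((A.filter fun a => ω ∈ openConn o a).card : ℝ) < κ * (∑ a ∈ A, (prodBernoulli w).real (openConn o a))} ≤
      3 / 2 * s := by
  by_cases hFe : (A \ B).Nonempty
  · obtain ⟨d, hd⟩ := hFe
    have hd' := Finset.mem_sdiff.1 hd
    have hdisj : Disjoint B {d} := Finset.disjoint_singleton_right.2 hd'.2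
    refine real_lowerTail_le_three_halves_of_two_glued_blocks_mean n w A o t d B {d} hBA (Finset.singleton_subset_iff.2 hd'.1)
      hdisj hne (Finset.singleton_nonempty d) hglue ?_ (by linarith) ?_ hs hrel
    · intro b hb
      rw [Finset.mem_singleton.1 hb]
      have : (openConn d d : Set (BondConfig (Fin n))) = univ := Set.eq_univ_of_forall fun ω => SimpleGraph.Reachable.refl _
      rw [this, Set.compl_univ, measureReal_empty]
    · rw [Finset.card_singleton]
      exact_mod_cast hEN
  · have h0 : (A \ B).card = 0 := Finset.card_eq_zero.2 (Finset.not_nonempty_iff_eq_empty.1 hFe)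
    exact real_lowerTail_le_three_halves_of_glued_block n w A o t B hBA hglue (by omega) hκ0 hκ hs hrel

/-- **(LT³⁄₂) whenever some vertex has at least `κ·EN − 2` relay points almost surely glued to it** — `Consts.LinearLowerTailThreeHalves`
restricted to this class, in its quantifier shape (any observer, any `|A|`, any further structure).  With no glued point the hypothesis
reads `κ·EN ≤ 2` and the low-mean theorem `Consts.real_lowerTail_le_three_halves_of_mul_mean_le_four_any` applies.
[cite: KozmaNitzan2024, Conj. 1 (p. 3)] -/
theorem linearLowerTailThreeHalves_of_glued_block_mean :
    ∀ κ : ℝ, 0 < κ → κ ≤ 2 / 3 →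
      ∀ (n : ℕ) (w : Sym2 (Fin n) → unitInterval) (A : Finset (Fin n)) (o : Fin n) (s : ℝ), 0 ≤ s →
        (∃ t : Fin n, κ * (∑ a ∈ A, (prodBernoulli w).real (openConn o a)) ≤
            ((A.filter fun a => (prodBernoulli w).real (openConn t a)ᶜ = 0).card + 2 : ℕ)) →
        (∀ a ∈ A, ∀ a' ∈ A, (prodBernoulli w).real (openConn a a')ᶜ ≤ s) →
        (prodBernoulli w).real {ω : BondConfig (Fin n) | 1 ≤ (A.filter fun a => ω ∈ openConn o a).card ∧
            ((A.filter fun a => ω ∈ openConn o a).card : ℝ) < κ * (∑ a ∈ A, (prodBernoulli w).real (openConn o a))} ≤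
          3 / 2 * s := by
  intro κ hκ0 hκ n w A o s hs ht hrel
  obtain ⟨t, hEN⟩ := ht
  set B := A.filter fun a => (prodBernoulli w).real (openConn t a)ᶜ = 0 with hB
  by_cases hne : B.Nonempty
  · exact real_lowerTail_le_three_halves_of_glued_block_mean n w A o t B (Finset.filter_subset _ _) hne
      (fun b hb => (Finset.mem_filter.1 hb).2) hκ0 hκ hEN hs hrel
  · have h0 : B.card = 0 := Finset.card_eq_zero.2 (Finset.not_nonempty_iff_eq_empty.1 hne)
    rw [h0] at hEN
    refine real_lowerTail_le_three_halves_of_mul_mean_le_four_any n w A o hκ0 hκ hs ?_ hrel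
    have : ((0 + 2 : ℕ) : ℝ) ≤ 4 := by norm_num
    exact hEN.trans this

end Consts

end Summit.CriticalPhenomena.PercolationContinuityZ3.Theorems
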